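import Summits.CriticalPhenomena.CardyFormulaZ2.Theorems.CardyComplexConeEdgePrecompactUFRSTwoArcClosing
import Summits.CriticalPhenomena.CardyFormulaZ2.Theorems.CardyComplexConeDefs
import Literature.Probability.LatticeModels.InnerFacesHoleFree

/-!
# Corner paths through the non-inner faces of a Jordan Dobrushin datum (the exterior closing path)
(line `qkz-strip-boundary-arm` of crux `CardyComplexCone.EdgePrecompact`, stmt-CriticalPhenomena-11387;
first foundational input of the trail-based planar analysis of the START-pair residual shared by
`ufrs_initialContactCase_certJ` and `ufrs_slippedReturnCase_certJ`, see `…UFRSStartPairReturn.lean`)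

A medial exploration of an admissible datum `E` runs, as an orbit of Smirnov's successor map, through
corners whose faces are INNER for `E`, from the start corner `a` (entering through the `A`–`B` edge
`e_a`) to the exit corner at `e_b`, after which the successor map steps into the OUTER face of `e_b`.
To apply the tree's combinatorial Umlaufsatz (`MedialTrail.inv_of_isTrail`, and the two-trail
comparison `twoTrail_turn_sub_SR` of `…UFRSTwoArcCore.lean`) to explorations one closes them into
closed trails of the oriented medial graph by a CORNER PATH THROUGH NON-INNER FACES from the corner
after the exit back to the corner `pre_a = (a.1, a.2 + 3)` before the start (whose successor is `a` in
every completed configuration): such a path shares no dart with any exploration of `E`, and the same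
path translated by `w` closes the explorations of `shiftData E w`.

* `ufrs_exteriorClosing_ST` (registered): for an admissible datum `E` of a Jordan Dobrushin domain and
  ANY two corners `c₀`, `c₁` with non-inner faces there is a corner path `κ 0 = c₀, …, κ M = c₁`, each
  step a left turn `(v, k) ↦ (v, k + 1)` or a right turn `(v, k) ↦ (v + cornerUnit (k + 1), k + 3)` (the
  two branches of `nextCorner`), through corners with NON-inner faces, visiting pairwise distinct corners.
  PROOF: the set of inner faces is hole-free (`holeFree_innerFaces`): both faces are joined through
  side-adjacent non-inner faces to faces above the bounding box of the inner faces, where any two faces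
  are joined by an explicit staircase; a chain of side-adjacent faces lifts to a corner path (at most three
  right turns inside a face, then the left turn across the common side, `liftFaceChain_ST`), a final
  rotation reaches `c₁`, and loop erasure (`loopErase_SR`) makes the corners distinct.

References: S. Smirnov, Ann. of Math. 172 (2010), §3 ("connected and simply connected" lattice
domains), §4 Fig. 5 (oriented medial lattice); H. Hopf, Compositio Math. 2 (1935).
-/

set_option linter.unusedVariables false

namespace Summit.CriticalPhenomena.CardyFormulaZ2.Cruxes.EdgePrecompact.QkzStripBoundaryArm

open MeasureTheory Filter Set Metric
open scoped Topology BigOperators Pointwise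
open Literature.Probability.LatticeModels Literature.Probability.Percolation
open Literature.Probability.RandomPlanarGeometry (DobrushinDomain)
open Summit.CriticalPhenomena.CardyFormulaZ2.Theses.CardyComplexCone

noncomputable section

/-! ## The two free moves of a corner path: left turn (cross the target edge), right turn (follow it) -/

/-- Left turn: cross the target edge into the next face counter-clockwise around the same vertex. -/
def lStep (c : Site 2 × Fin 4) : Site 2 × Fin 4 := (c.1, c.2 + 1)

/-- Right turn: follow the target edge inside the same face. -/
def rStep (c : Site 2 × Fin 4) : Site 2 × Fin 4 := (c.1 + cornerUnit (c.2 + 1), c.2 + 3)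


/-- A right turn keeps the face. -/
theorem cFace_rStep_ST (c : Site 2 × Fin 4) : cFace (rStep c) = cFace c := by
  obtain ⟨v, k⟩ := c
  have e1 : k + 1 + 2 = k + 3 := by revert k; decide
  have e2 : k + 1 + 3 = k := by revert k; decide
  simp only [rStep, cFace]
  have h := faceAt_add_unit_add_two v (k + 1)
  rw [e1, e2] at h
  exact h

/-- A left turn moves to the side-adjacent face `cFace c + cornerUnit (c.2 + 2)`. -/
theorem cFace_lStep_ST (c : Site 2 × Fin 4) : cFace (lStep c) = cFace c + cornerUnit (c.2 + 2) := by
  obtain ⟨v, k⟩ := c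
  simp only [lStep, cFace]
  exact faceAt_succ_eq v k

/-- Iterated right turns keep the face. -/
theorem cFace_rStep_iterate_ST (c : Site 2 × Fin 4) : ∀ r : ℕ, cFace (rStep^[r] c) = cFace c
  | 0 => rfl
  | r + 1 => by rw [Function.iterate_succ_apply', cFace_rStep_ST, cFace_rStep_iterate_ST c r]

/-- Four right turns go once around the face. -/
theorem rStep_iterate_four_ST (c : Site 2 × Fin 4) : rStep^[4] c = c := by
  obtain ⟨v, k⟩ := c
  have hsum : cornerUnit (k + 1) + cornerUnit (k + 3 + 1) + cornerUnit (k + 3 + 3 + 1) + cornerUnit (k + 3 + 3 + 3 + 1) = 0 := by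
    fin_cases k <;> decide
  have hk : k + 3 + 3 + 3 + 3 = k := by revert k; decide
  show ((v + cornerUnit (k + 1) + cornerUnit (k + 3 + 1) + cornerUnit (k + 3 + 3 + 1) + cornerUnit (k + 3 + 3 + 3 + 1), k + 3 + 3 + 3 + 3) : Site 2 × Fin 4) = (v, k)
  rw [hk, add_assoc v, add_assoc v, add_assoc v, hsum, add_zero]

/-- A corner is determined by its face and its face index. -/
theorem eq_of_cFace_eq_of_snd_eq_ST {p q : Site 2 × Fin 4} (hf : cFace p = cFace q) (hk : p.2 = q.2) : p = q := by
  obtain ⟨v, k⟩ := p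
  obtain ⟨v', k'⟩ := q
  simp only at hk
  subst hk
  simp only [cFace, faceAt] at hf
  exact Prod.ext (sub_left_injective hf) rfl

/-- From a corner of a face, at most three further right turns reach any corner of the same face:
`rStep^[r] c = c'` for some `1 ≤ r ≤ 4`. -/
theorem exists_rStep_iterate_eq_ST {c c' : Site 2 × Fin 4} (h : cFace c = cFace c') :
    ∃ r : ℕ, 1 ≤ r ∧ r ≤ 4 ∧ rStep^[r] c = c' := by
  have key : ∀ k k' : Fin 4, k + 3 = k' ∨ k + 3 + 3 = k' ∨ k + 3 + 3 + 3 = k' ∨ k + 3 + 3 + 3 + 3 = k' := by decide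
  have h1 : (rStep^[1] c).2 = c.2 + 3 := rfl
  have h2 : (rStep^[2] c).2 = c.2 + 3 + 3 := rfl
  have h3 : (rStep^[3] c).2 = c.2 + 3 + 3 + 3 := rfl
  have h4 : (rStep^[4] c).2 = c.2 + 3 + 3 + 3 + 3 := rfl
  rcases key c.2 c'.2 with e | e | e | e
  · exact ⟨1, le_rfl, by omega, eq_of_cFace_eq_of_snd_eq_ST ((cFace_rStep_iterate_ST c 1).trans h) (h1.trans e)⟩
  · exact ⟨2, by omega, by omega, eq_of_cFace_eq_of_snd_eq_ST ((cFace_rStep_iterate_ST c 2).trans h) (h2.trans e)⟩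
  · exact ⟨3, by omega, by omega, eq_of_cFace_eq_of_snd_eq_ST ((cFace_rStep_iterate_ST c 3).trans h) (h3.trans e)⟩
  · exact ⟨4, by omega, le_rfl, eq_of_cFace_eq_of_snd_eq_ST ((cFace_rStep_iterate_ST c 4).trans h) (h4.trans e)⟩

/-- The number of right turns after which the left turn crosses the side in direction `j`. -/
def rCount (k j : Fin 4) : ℕ := if k + 2 = j then 0 else if k + 3 + 2 = j then 1 else if k + 3 + 3 + 2 = j then 2 else 3

/-- `rCount` does its job: after `rCount k j` right turns from `(v, k)` the face index `k'` has `k' + 2 = j`. -/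
theorem rCount_spec_ST (v : Site 2) (k j : Fin 4) : (rStep^[rCount k j] (v, k)).2 + 2 = j := by
  have h0 : (rStep^[0] (v, k)).2 = k := rfl
  have h1 : (rStep^[1] (v, k)).2 = k + 3 := rfl
  have h2 : (rStep^[2] (v, k)).2 = k + 3 + 3 := rfl
  have h3 : (rStep^[3] (v, k)).2 = k + 3 + 3 + 3 := rfl
  have key : ∀ k j : Fin 4, ¬ k + 2 = j → ¬ k + 3 + 2 = j → ¬ k + 3 + 3 + 2 = j → k + 3 + 3 + 3 + 2 = j := by decide
  unfold rCount
  split_ifs with e0 e1 e2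
  · rw [h0]; exact e0
  · rw [h1]; exact e1
  · rw [h2]; exact e2
  · rw [h3]; exact key k j e0 e1 e2

/-- The corner path of the right turns `rStep c, …, rStep^[r] c` (without `c`). -/
def rList (c : Site 2 × Fin 4) (r : ℕ) : List (Site 2 × Fin 4) := (List.range r).map fun i => rStep^[i + 1] c

/-- `rList c r` is a free-step chain inside the face of `c`, attachable after `c`, ending at `rStep^[r] c`. -/
theorem rList_spec_ST (c : Site 2 × Fin 4) (r : ℕ) :
    List.IsChain (fun c c' : Site 2 × Fin 4 => c' = lStep c ∨ c' = rStep c) (rList c r) ∧ (∀ c' ∈ rList c r, cFace c' = cFace c) ∧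
      (∀ y ∈ (rList c r).head?, (fun c c' : Site 2 × Fin 4 => c' = lStep c ∨ c' = rStep c) c y) ∧ (1 ≤ r → (rList c r).getLast? = some (rStep^[r] c)) := by
  refine ⟨?_, ?_, ?_, ?_⟩
  · rw [rList]
    refine isChain_map_range_SR _ _ fun i _ => Or.inr ?_
    rw [Function.iterate_succ_apply' rStep (i + 1)]
  · intro c' hc'
    simp only [rList, List.mem_map, List.mem_range] at hc'
    obtain ⟨i, -, rfl⟩ := hc'
    exact cFace_rStep_iterate_ST c (i + 1)
  · intro y hy
    rcases Nat.eq_zero_or_pos r with rfl | hr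
    · simp [rList] at hy
    · obtain ⟨r', rfl⟩ : ∃ r', r = r' + 1 := ⟨r - 1, by omega⟩
      rw [rList, List.range_succ_eq_map, List.map_cons, List.head?_cons, Option.mem_def, Option.some.injEq] at hy
      rw [← hy]
      exact Or.inr rfl
  · intro hr
    rw [rList, List.getLast?_eq_getElem?, List.length_map, List.length_range, List.getElem?_map,
      List.getElem?_range (by omega)]
    simp only [Option.map_some, Option.some.injEq]
    rw [Nat.sub_add_cancel hr]

/-! ## Lifting a chain of side-adjacent faces to a corner path -/

/-- **Lifting.** A chain of side-adjacent faces `f :: L` and a corner `c` of `f` lift to a free-step chain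
of corners from `c` whose faces are among `f :: L` and whose last corner lies in the last face. -/
theorem liftFaceChain_ST : ∀ (L : List (Site 2)) (f : Site 2) (c : Site 2 × Fin 4),
    List.IsChain (fun g g' : Site 2 => (zdGraph 2).Adj g g') (f :: L) → cFace c = f →
    ∃ W : List (Site 2 × Fin 4), W ≠ [] ∧ W.head? = some c ∧ List.IsChain (fun c c' : Site 2 × Fin 4 => c' = lStep c ∨ c' = rStep c) W ∧
      (∀ c' ∈ W, cFace c' ∈ f :: L) ∧ ∃ cl, W.getLast? = some cl ∧ cFace cl = (f :: L).getLast (List.cons_ne_nil _ _)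
  | [], f, c, _, hc => ⟨[c], List.cons_ne_nil _ _, rfl, List.IsChain.singleton _, fun c' hc' => by
      rw [List.mem_singleton] at hc'; rw [hc', hc]; exact List.mem_singleton.2 rfl, c, rfl, hc⟩
  | g :: L, f, c, hch, hc => by
    rw [List.isChain_cons_cons] at hch
    obtain ⟨hfg, hch'⟩ := hch
    obtain ⟨j, hj⟩ := Literature.Probability.LatticeModels.exists_eq_add_cornerUnit hfg
    -- right turns inside `f`, then the left turn into `g`
    set r := rCount c.2 j with hr
    set c₁ := rStep^[r] c with hc₁
    set c₂ := lStep c₁ with hc₂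
    have hc₁f : cFace c₁ = f := (cFace_rStep_iterate_ST c r).trans hc
    have hc₂g : cFace c₂ = g := by
      rw [hc₂, cFace_lStep_ST, hc₁f, hj, hc₁, hr]
      obtain ⟨v, k⟩ := c
      rw [rCount_spec_ST v k j]
    obtain ⟨W', hW'ne, hW'hd, hW'ch, hW'mem, cl, hcl, hclface⟩ := liftFaceChain_ST L g c₂ hch' hc₂g
    obtain ⟨hRch, hRface, hRhd, hRlast⟩ := rList_spec_ST c r
    refine ⟨c :: (rList c r ++ W'), List.cons_ne_nil _ _, rfl, ?_, ?_, cl, ?_, ?_⟩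
    · rw [List.isChain_cons]
      refine ⟨?_, List.IsChain.append hRch hW'ch ?_⟩
      · intro y hy
        rcases Nat.eq_zero_or_pos r with h0 | hpos
        · rw [h0] at hy
          simp only [rList, List.range_zero, List.map_nil, List.nil_append] at hy
          rw [hW'hd, Option.mem_def, Option.some.injEq] at hy
          rw [← hy, hc₂, hc₁, h0]
          exact Or.inl rfl
        · obtain ⟨r', hr'⟩ : ∃ r', r = r' + 1 := ⟨r - 1, by omega⟩
          have hne : rList c r ≠ [] := by rw [hr', rList]; simp
          obtain ⟨x, xs, hx⟩ := List.exists_cons_of_ne_nil hne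
          rw [hx, List.cons_append, List.head?_cons, Option.mem_def, Option.some.injEq] at hy
          rw [← hy]
          exact hRhd x (by rw [hx]; rfl)
      · intro x hx y hy
        rcases Nat.eq_zero_or_pos r with h0 | hpos
        · rw [h0] at hx; simp [rList] at hx
        · rw [hRlast hpos, Option.mem_def, Option.some.injEq] at hx
          rw [hW'hd, Option.mem_def, Option.some.injEq] at hy
          rw [← hx, ← hy, hc₂, hc₁]
          exact Or.inl rfl
    · intro c' hc'
      rw [List.mem_cons, List.mem_append] at hc'
      rcases hc' with rfl | h | h
      · rw [hc]; exact List.mem_cons_self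
      · rw [hRface c' h, hc]; exact List.mem_cons_self
      · exact List.mem_cons_of_mem _ (hW'mem c' h)
    · rw [List.getLast?_cons, List.getLast?_append, hcl]
      rfl
    · rw [hclface]
      rfl

/-! ## Chains of non-inner faces: hole-freeness and the half-plane above the inner faces -/

section FaceChains

variable {E : DiscreteDobrushin}

/-- A `FaceStep`-path from the reflexive-transitive closure, as a list of faces off `P` starting at `g`. -/
theorem exists_list_of_reflTransGen_faceStep_ST {P : Set (Site 2)} {g g' : Site 2} (hg : g ∉ P)
    (h : Relation.ReflTransGen (FaceStep P) g g') :
    ∃ L : List (Site 2), List.IsChain (fun f f' : Site 2 => (zdGraph 2).Adj f f') (g :: L) ∧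
      (∀ f ∈ g :: L, f ∉ P) ∧ (g :: L).getLast (List.cons_ne_nil _ _) = g' := by
  obtain ⟨L, hch, hlast⟩ := List.exists_isChain_cons_of_relationReflTransGen h
  refine ⟨L, List.IsChain.imp (fun a b hab => hab.1) hch, ?_, hlast⟩
  have := List.IsChain.induction (fun f => f ∉ P) (g :: L) hch (fun x y hxy _ => hxy.2.2) (fun _ => hg)
  exact this

/-- The symmetric of a `FaceStep` closure. -/
theorem reflTransGen_faceStep_symm_ST {P : Set (Site 2)} {g g' : Site 2}
    (h : Relation.ReflTransGen (FaceStep P) g g') : Relation.ReflTransGen (FaceStep P) g' g := by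
  induction h with
  | refl => exact Relation.ReflTransGen.refl
  | tail _ hst ih => exact Relation.ReflTransGen.head ⟨hst.1.symm, hst.2.2, hst.2.1⟩ ih

/-- Straight runs of faces off `P` are `FaceStep`-chains. -/
theorem reflTransGen_faceStep_nsmul_ST {P : Set (Site 2)} (f : Site 2) (k : Fin 4) :
    ∀ n : ℕ, (∀ i ≤ n, f + i • cornerUnit k ∉ P) → Relation.ReflTransGen (FaceStep P) f (f + n • cornerUnit k)
  | 0, _ => by rw [zero_nsmul, add_zero]
  | n + 1, h => by
    refine Relation.ReflTransGen.tail (reflTransGen_faceStep_nsmul_ST f k n fun i hi => h i (by omega)) ⟨?_, h n (by omega), h (n + 1) le_rfl⟩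
    rw [add_succ_nsmul_cornerUnit]
    exact zdGraph_adj_add_cornerUnit _ _

/-- The inner faces lie below some height `Y₂`. -/
theorem exists_top_innerFaces_ST (hΩ : Bornology.IsBounded E.Ω) (hδ : 0 < E.δ) :
    ∃ Y₂ : ℤ, ∀ f : Site 2, E.IsInnerFace f → f 1 ≤ Y₂ := by
  have hfin : {f : Site 2 | E.IsInnerFace f}.Finite := finite_hasAllSides hΩ hδ
  obtain ⟨Y₂, hY₂⟩ := (hfin.image fun f => f 1).bddAbove
  exact ⟨Y₂, fun f hf => hY₂ ⟨f, hf, rfl⟩⟩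

/-- Two faces strictly above the inner faces are joined by face steps off the inner faces (up, across, down). -/
theorem reflTransGen_high_ST {Y₂ : ℤ} (htop : ∀ f : Site 2, E.IsInnerFace f → f 1 ≤ Y₂) {h₀ h₁ : Site 2}
    (hh₀ : Y₂ < h₀ 1) (hh₁ : Y₂ < h₁ 1) :
    Relation.ReflTransGen (FaceStep {f : Site 2 | E.IsInnerFace f}) h₀ h₁ := by
  have hout : ∀ f : Site 2, Y₂ < f 1 → f ∉ {f : Site 2 | E.IsInnerFace f} := fun f hf hin => (htop f hin).not_gt hf
  -- up from `h₀` to the height `max (h₀ 1) (h₁ 1)`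
  set H := max (h₀ 1) (h₁ 1) with hH
  obtain ⟨n₀, hn₀⟩ : ∃ n₀ : ℕ, h₀ 1 + n₀ = H := ⟨(H - h₀ 1).toNat, by rw [Int.toNat_of_nonneg (by omega)]; ring⟩
  set p₀ := h₀ + n₀ • cornerUnit 1 with hp₀
  have hp₀c : p₀ 0 = h₀ 0 ∧ p₀ 1 = H := by
    rw [hp₀, add_nsmul_cornerUnit_apply, add_nsmul_cornerUnit_apply]; simp [cornerUnit]; omega
  have s1 : Relation.ReflTransGen (FaceStep {f : Site 2 | E.IsInnerFace f}) h₀ p₀ :=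
    reflTransGen_faceStep_nsmul_ST h₀ 1 n₀ fun i hi => hout _ (by rw [add_nsmul_cornerUnit_apply]; simp [cornerUnit]; omega)
  -- up from `h₁` to the same height
  obtain ⟨n₁, hn₁⟩ : ∃ n₁ : ℕ, h₁ 1 + n₁ = H := ⟨(H - h₁ 1).toNat, by rw [Int.toNat_of_nonneg (by omega)]; ring⟩
  set p₁ := h₁ + n₁ • cornerUnit 1 with hp₁
  have hp₁c : p₁ 0 = h₁ 0 ∧ p₁ 1 = H := by
    rw [hp₁, add_nsmul_cornerUnit_apply, add_nsmul_cornerUnit_apply]; simp [cornerUnit]; omega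
  have s3 : Relation.ReflTransGen (FaceStep {f : Site 2 | E.IsInnerFace f}) p₁ h₁ :=
    reflTransGen_faceStep_symm_ST (reflTransGen_faceStep_nsmul_ST h₁ 1 n₁ fun i hi => hout _ (by rw [add_nsmul_cornerUnit_apply]; simp [cornerUnit]; omega))
  -- across at height `H`
  have s2 : Relation.ReflTransGen (FaceStep {f : Site 2 | E.IsInnerFace f}) p₀ p₁ := by
    rcases le_or_gt (p₀ 0) (p₁ 0) with hle | hgt
    · obtain ⟨m, hm⟩ : ∃ m : ℕ, p₀ 0 + m = p₁ 0 := ⟨(p₁ 0 - p₀ 0).toNat, by rw [Int.toNat_of_nonneg (by omega)]; ring⟩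
      have heq : p₁ = p₀ + m • cornerUnit 0 := by
        ext i; fin_cases i <;> simp [cornerUnit] <;> omega
      rw [heq]
      exact reflTransGen_faceStep_nsmul_ST p₀ 0 m fun i hi => hout _ (by rw [add_nsmul_cornerUnit_apply]; simp [cornerUnit]; omega)
    · obtain ⟨m, hm⟩ : ∃ m : ℕ, p₁ 0 + m = p₀ 0 := ⟨(p₀ 0 - p₁ 0).toNat, by rw [Int.toNat_of_nonneg (by omega)]; ring⟩
      have heq : p₁ = p₀ + m • cornerUnit 2 := by
        ext i; fin_cases i <;> simp [cornerUnit] <;> omega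
      rw [heq]
      exact reflTransGen_faceStep_nsmul_ST p₀ 2 m fun i hi => hout _ (by rw [add_nsmul_cornerUnit_apply]; simp [cornerUnit]; omega)
  exact (s1.trans s2).trans s3

/-- **Any two non-inner faces of a Jordan datum are joined by a chain of side-adjacent non-inner faces.** -/
theorem exists_faceChain_ST (D : DobrushinDomain) (hΩ : E.Ω = D.carrier) (hE : E.IsZdAdmissible) {g₀ g₁ : Site 2}
    (hg₀ : ¬ E.IsInnerFace g₀) (hg₁ : ¬ E.IsInnerFace g₁) :
    ∃ L : List (Site 2), List.IsChain (fun f f' : Site 2 => (zdGraph 2).Adj f f') (g₀ :: L) ∧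
      (∀ f ∈ g₀ :: L, ¬ E.IsInnerFace f) ∧ (g₀ :: L).getLast (List.cons_ne_nil _ _) = g₁ := by
  have hδ : 0 < E.δ := hE.delta_pos
  have hΩb : Bornology.IsBounded E.Ω := by rw [hΩ]; exact D.isBounded
  have hHF := holeFree_innerFaces (E := E) D.toJordanDomain hΩ hδ
  obtain ⟨Y₂, htop⟩ := exists_top_innerFaces_ST hΩb hδ
  obtain ⟨h₀, hh₀, r₀⟩ := hHF g₀ hg₀ (Y₂ + 1)
  obtain ⟨h₁, hh₁, r₁⟩ := hHF g₁ hg₁ (Y₂ + 1)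
  have r : Relation.ReflTransGen (FaceStep {f : Site 2 | E.IsInnerFace f}) g₀ g₁ :=
    (r₀.trans (reflTransGen_high_ST htop (by omega) (by omega))).trans (reflTransGen_faceStep_symm_ST r₁)
  exact exists_list_of_reflTransGen_faceStep_ST hg₀ r

end FaceChains

/-! ## The exterior closing path -/

/-- **Corner paths through the non-inner faces** (registered helper `ufrs_exteriorClosing_ST` of
stmt-CriticalPhenomena-11387). For an admissible datum `E` of the Jordan Dobrushin domain `D` and any
two corners `c₀`, `c₁` whose faces are NOT inner, there is a corner path `κ 0 = c₀, …, κ M = c₁` each of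
whose steps is a left turn `(v, k) ↦ (v, k + 1)` or a right turn `(v, k) ↦ (v + cornerUnit (k + 1), k + 3)`,
all of whose corners have non-inner faces, with pairwise distinct corners. (Used with `c₀` the corner
after the exit of an exploration and `c₁ = (a.1, a.2 + 3)` the corner before its start: the exterior
closing path of the trail-based planar analysis.) -/
theorem ufrs_exteriorClosing_ST : ∀ (D : DobrushinDomain) (E : DiscreteDobrushin), E.Ω = D.carrier → E.IsZdAdmissible → ∀ (c₀ c₁ : Site 2 × Fin 4), ¬ E.IsInnerFace (cFace c₀) → ¬ E.IsInnerFace (cFace c₁) → ∃ (κ : ℕ → Site 2 × Fin 4) (M : ℕ), κ 0 = c₀ ∧ κ M = c₁ ∧ (∀ i < M, κ (i + 1) = ((κ i).1, (κ i).2 + 1) ∨ κ (i + 1) = ((κ i).1 + cornerUnit ((κ i).2 + 1), (κ i).2 + 3)) ∧ (∀ i ≤ M, ¬ E.IsInnerFace (cFace (κ i))) ∧ (∀ i j, i ≤ M → j ≤ M → κ i = κ j → i = j) := by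
  intro D E hΩ hE c₀ c₁ hc₀ hc₁
  classical
  -- a chain of non-inner faces from the face of `c₀` to the face of `c₁`, lifted to corners
  obtain ⟨L, hch, hout, hlast⟩ := exists_faceChain_ST D hΩ hE hc₀ hc₁
  obtain ⟨W, hWne, hWhd, hWch, hWmem, cl, hcl, hclface⟩ := liftFaceChain_ST L (cFace c₀) c₀ hch rfl
  rw [hlast] at hclface
  -- a final rotation inside the face of `c₁`
  obtain ⟨r, hr1, hr4, hrot⟩ := exists_rStep_iterate_eq_ST hclface
  obtain ⟨hRch, hRface, hRhd, hRlast⟩ := rList_spec_ST cl r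
  set W₂ := W ++ rList cl r with hW₂
  have hW₂ch : List.IsChain (fun c c' : Site 2 × Fin 4 => c' = lStep c ∨ c' = rStep c) W₂ :=
    List.IsChain.append hWch hRch fun x hx y hy => by
      rw [hcl, Option.mem_def, Option.some.injEq] at hx
      rw [← hx]; exact hRhd y hy
  have hW₂ne : W₂ ≠ [] := List.append_ne_nil_of_left_ne_nil hWne _
  have hW₂hd : W₂.head? = some c₀ := by rw [hW₂, List.head?_append, hWhd]; rfl
  have hW₂last : W₂.getLast? = some c₁ := by rw [hW₂, List.getLast?_append, hRlast hr1, hrot]; rfl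
  have hW₂out : ∀ c ∈ W₂, ¬ E.IsInnerFace (cFace c) := by
    intro c hc
    rw [hW₂, List.mem_append] at hc
    rcases hc with hc | hc
    · exact hout _ (hWmem c hc)
    · rw [hRface c hc, hclface]; exact hc₁
  -- loop erasure
  obtain ⟨W₃, hW₃ne, hW₃hd, hW₃last, hW₃ch, hW₃nd, hW₃sub⟩ := loopErase_SR (fun c c' : Site 2 × Fin 4 => c' = lStep c ∨ c' = rStep c) W₂.length W₂ le_rfl hW₂ne hW₂ch
  rw [hW₂hd] at hW₃hd
  rw [hW₂last] at hW₃last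
  -- the path as a function
  obtain ⟨M, hM⟩ : ∃ M, W₃.length = M + 1 := ⟨W₃.length - 1, (Nat.sub_add_cancel (List.length_pos_iff.2 hW₃ne)).symm⟩
  refine ⟨fun i => if h : i < W₃.length then W₃[i] else c₀, M, ?_, ?_, ?_, ?_, ?_⟩
  · have h0 : 0 < W₃.length := by omega
    simp only [h0, dite_true]
    have := List.head?_eq_getElem?.symm.trans hW₃hd
    rw [List.getElem?_eq_getElem h0, Option.some.injEq] at this
    exact this
  · have hMl : M < W₃.length := by omega
    simp only [hMl, dite_true]
    have := (List.getLast?_eq_getElem?).symm.trans hW₃last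
    rw [hM, Nat.add_sub_cancel, List.getElem?_eq_getElem hMl, Option.some.injEq] at this
    exact this
  · intro i hi
    have h1 : i < W₃.length := by omega
    have h2 : i + 1 < W₃.length := by omega
    simp only [h1, h2, dite_true]
    exact (List.isChain_iff_getElem.1 hW₃ch) i h2
  · intro i hi
    have h1 : i < W₃.length := by omega
    simp only [h1, dite_true]
    exact hW₂out _ (hW₃sub _ (List.getElem_mem h1))
  · intro i j hi hj hij
    have h1 : i < W₃.length := by omega
    have h2 : j < W₃.length := by omega
    simp only [h1, h2, dite_true] at hij
    exact (hW₃nd.getElem_inj_iff).1 hij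

end

end Summit.CriticalPhenomena.CardyFormulaZ2.Cruxes.EdgePrecompact.QkzStripBoundaryArm
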